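import Summits.Ventures.PercRepro.RankLevelSetLevelSixHeavyCell
import Summits.Ventures.PercRepro.RankLevelSetLevelSix
import Summits.Ventures.PercRepro.S1FourCircuitCount
import Summits.Ventures.PercRepro.RankLevelSetPlaneSix
import Summits.Ventures.PercRepro.RankLevelSetTriangleStar
import Summits.Ventures.PercRepro.S1TrianglePlusPlus

/-!
# PercRepro — THE TREE'S CIRCUIT BOUNDS ON THE `e`-FREE CORE, PACKAGED (p8 g4, S3)

`proofs/SUBCLAIM-S3-p8.md` §3p. The two circuit bounds the cell theorem `c025_core_six_heavy_cell_sq33d`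
(RankLevelSetLevelSixHeavyCellSq33D) takes as hypotheses, derived from the tree on the `e`-free core: LEMMA T⁺⁺ (p1,
S1TrianglePlusPlus) `s₃ ≤ (d² − 3d + 8)/2` and LEMMA T4 (p2, S1FourCircuitCount) `s₄ ≤ d(d + 1)(d + 2)/3` — each under the
line and plane bounds of the core (`ncard_le_three_of_eRk_two`, `ncard_le_six_of_eRk_le_three_of_free`). Axioms: standard.
-/

open scoped Matroid

namespace PercRepro

namespace ThmN

open Set

variable {α : Type}

/-- LEMMA T⁺⁺ on the `e`-free core: `s₃ ≤ (d² − 3d + 8)/2` (p1's `S1.ncard_triangles_le_of_nullity_plane` under the line and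
plane bounds of the core). -/
theorem ncard_triangles_le_tpp_of_free (M : Matroid α) [M.Finite] (d : ℕ)
    (hd : M.E.encard = M.eRank + d)
    (hfree : ∀ e ∈ M.E, ∃ A ⊆ M.E \ {e}, e ∉ M.closure A ∧ e ∉ M.closure ((M.E \ {e}) \ A)) :
    {C | M.IsCircuit C ∧ C.ncard = 3}.ncard ≤ (d * d + 8 - 3 * d) / 2 := by
  have hL : ∀ e ∈ M.E, ¬ M.IsLoop e := not_isLoop_of_free M hfree
  have hs : ∀ e ∈ M.E, ∀ f ∈ M.E, e ≠ f → M.eRk {e, f} = 2 := by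
    intro e he f hf hef
    have h2 : (2 : ℕ∞) ≤ M.eRk {e, f} :=
      two_le_eRk_of_two_le_ncard_of_free M hfree (pair_subset he hf) (by rw [ncard_pair hef])
    have h3 : M.eRk {e, f} ≤ 2 := by
      have := M.eRk_le_encard {e, f}
      rwa [encard_pair hef] at this
    exact le_antisymm h3 h2
  have hC1 : ∀ L ⊆ M.E, M.eRk L = 2 → L.ncard ≤ 3 :=
    fun L hL hr => ncard_le_three_of_eRk_two M hs hfree hL hr
  have hC2 : ∀ P ⊆ M.E, M.eRk P ≤ 3 → P.ncard ≤ 6 :=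
    fun P hP hr => ncard_le_six_of_eRk_le_three_of_free M hfree hP hr
  exact S1.ncard_triangles_le_of_nullity_plane M hC1 hC2 hd

/-- LEMMA T4 on the `e`-free core: `s₄ ≤ d(d + 1)(d + 2)/3` (p2's `S1.three_mul_ncard_four_circuits_le` under the line and
plane bounds of the core). -/
theorem ncard_fourCircuits_le_t4_of_free (M : Matroid α) [M.Finite] (d : ℕ)
    (hd : M.E.encard = M.eRank + d)
    (hfree : ∀ e ∈ M.E, ∃ A ⊆ M.E \ {e}, e ∉ M.closure A ∧ e ∉ M.closure ((M.E \ {e}) \ A)) :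
    {C | M.IsCircuit C ∧ C.ncard = 4}.ncard ≤ d * (d + 1) * (d + 2) / 3 := by
  have hL : ∀ e ∈ M.E, ¬ M.IsLoop e := not_isLoop_of_free M hfree
  have hC1' : ∀ L ⊆ M.E, M.eRk L ≤ 2 → L.ncard ≤ 3 := by
    intro L hL' hr
    have := ncard_add_one_le_two_pow_of_eRk_le M hL hfree 2 L hL' hr
    omega
  have hC2 : ∀ P ⊆ M.E, M.eRk P ≤ 3 → P.ncard ≤ 6 :=
    fun P hP hr => ncard_le_six_of_eRk_le_three_of_free M hfree hP hr
  have hT4 : 3 * {C : Set α | M.IsCircuit C ∧ C.ncard = 4}.ncard ≤ d * (d + 1) * (d + 2) :=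
    S1.three_mul_ncard_four_circuits_le M hC1' hC2 hd
  omega

end ThmN

end PercRepro
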